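import Mathlib.Analysis.Convex.Function
import Mathlib.Analysis.SpecialFunctions.Integrals.Basic
import Mathlib.MeasureTheory.Integral.Pi
import Literature.Probability.LatticeModels.LatticeGreenHeatKernel
import HarnessLib

/-!
# A piecewise-bilinear ("hat") MAJORANT quadrature for `∫_{[-π,π]²} g(cos x, cos y)`, `g` convex along each axis

Topic `Analysis/Quadrature`; companion of `KernelDyadicEnclosures` (arithmetic) and `FreeFermionPressureQuadrature` (the checker).
Written for the hubbard-tc cell (MO-S3; seat mod-2, 2026-08-27). The classical fact used is the CHORD (trapezoid) majorant of a
convex function (Hermite–Hadamard's upper half, Davis–Rabinowitz §2.1/§4.3): on nodes `u₀ < … < u_M` the piecewise-linear interpolant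
`Σ_p hat_p(v) φ(u_p)` dominates a convex `φ` on `[u₀, u_M]`; tensorising gives, for `g` convex in each variable separately and
`G_pq ≥ g(u_p, u_q) ≥ 0`,

  `g(cos x, cos y) ≤ Σ_{p,q} G_pq · hat_p(cos x) · hat_q(cos y)`   (all `x, y`),

hence `∫_{[-π,π]²} g(cos k₀, cos k₁) dk ≤ Σ_{p,q} G_pq Ω_p Ω_q`, `Ω_p = ∫_{-π}^{π} hat_p(cos x) dx` (Fubini on the Brillouin square),
and the `Ω_p` are EXPLICIT: with `R(c) = ∫_{-π}^{π} (cos x - c)⁺ dx = 2(sin θ - θ cos θ)` (`c = cos θ`),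
`Ω_p = (R(u_{p-1}) - R(u_p))/(u_p - u_{p-1}) - (R(u_p) - R(u_{p+1}))/(u_{p+1} - u_p)` in the interior,
`Ω_0 = (2π u_1 + R(u_1))/(u_1 - u_0)`, `Ω_M = R(u_{M-1})/(u_M - u_{M-1})`.

* §1 `hat`, `hat_nonneg`, `continuous_hat`;  §2 `le_sum_hat_mul` (chord majorant);  §3 `le_sum_sum_hat_mul` (tensor form);
* §4 `integral_relu_cos_sub_cos` (`R`);  §5 `integral_hat_cos_*` (the three `Ω` formulas);
* §6 `setIntegral_brillouin_two_le_sum_hat` (the quadrature inequality on `brillouin 2`).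

Everything is PROVED (standard axioms); no named fact. HONEST FRAMING: a quadrature MAJORANT (one-sided), second-order accurate for
smooth convex-along-axes integrands; nothing physical here.

References: Davis–Rabinowitz, *Methods of Numerical Integration* (1984), §2.1 (trapezoid = chord; one-sided for convex integrands),
§5.6 (product rules) [cite: DavisRabinowitz1984, Sect. 2.1]; Hardy–Littlewood–Pólya, *Inequalities*, Thm 90 / §3.5 (convex functions
lie below chords) [cite: HardyLittlewoodPolya1952, §3.5]; Rudin 1976 Thm 6.12 (monotonicity / linearity of the integral)
[cite: Rudin1976, Thm 6.12].
-/

namespace Literature.Analysis.Quadrature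

namespace KernelQuadrature

open Real Set MeasureTheory Finset Literature.Probability.LatticeModels
open scoped BigOperators

/-! ### §1 Hat functions on a node family -/

/-- The hat (piecewise-linear Lagrange) basis function of node `p` for nodes `u 0 < u 1 < … < u M`
(one-sided at `p = 0` and `p = M`). [cite: DavisRabinowitz1984, Sect. 2.1] -/
noncomputable def hat (u : ℕ → ℝ) (M p : ℕ) (v : ℝ) : ℝ :=
  if p = 0 then max 0 ((u 1 - v) / (u 1 - u 0))
  else if p = M then max 0 ((v - u (M - 1)) / (u M - u (M - 1)))
  else max 0 (min ((v - u (p - 1)) / (u p - u (p - 1))) ((u (p + 1) - v) / (u (p + 1) - u p)))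

/-- Hats are nonnegative. [cite: DavisRabinowitz1984, Sect. 2.1] -/
theorem hat_nonneg (u : ℕ → ℝ) (M p : ℕ) (v : ℝ) : 0 ≤ hat u M p v := by
  unfold hat
  split_ifs <;> exact le_max_left _ _

/-- Hats are continuous. [cite: DavisRabinowitz1984, Sect. 2.1] -/
theorem continuous_hat (u : ℕ → ℝ) (M p : ℕ) : Continuous (hat u M p) := by
  unfold hat
  split_ifs
  · exact continuous_const.max ((continuous_const.sub continuous_id).div_const _)
  · exact continuous_const.max ((continuous_id.sub continuous_const).div_const _)
  · exact continuous_const.max (((continuous_id.sub continuous_const).div_const _).min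
      ((continuous_const.sub continuous_id).div_const _))

/-! ### §2 The chord majorant on a node family -/

/-- Monotonicity of nodes from strict steps. [folklore] -/
private theorem node_mono {u : ℕ → ℝ} {M : ℕ} (hu : ∀ p < M, u p < u (p + 1)) :
    ∀ p q, p ≤ q → q ≤ M → u p ≤ u q := by
  intro p q hpq hqM
  induction q, hpq using Nat.le_induction with
  | base => exact le_rfl
  | succ q hpq ih => exact (ih (Nat.le_of_succ_le hqM)).trans (hu q (Nat.lt_of_succ_le hqM)).le

/-- Every point of `[u 0, u M]` lies in some cell `[u k, u (k+1)]`. [folklore] -/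
private theorem exists_cell {u : ℕ → ℝ} {M : ℕ} (hM : 1 ≤ M) {v : ℝ} (h0 : u 0 ≤ v) (h1 : v ≤ u M) :
    ∃ k < M, u k ≤ v ∧ v ≤ u (k + 1) := by
  induction M, hM using Nat.le_induction generalizing v with
  | base => exact ⟨0, Nat.zero_lt_one, h0, h1⟩
  | succ M hM ih =>
    by_cases hv : v ≤ u M
    · obtain ⟨k, hk, hk1, hk2⟩ := ih h0 hv
      exact ⟨k, Nat.lt_succ_of_lt hk, hk1, hk2⟩
    · exact ⟨M, Nat.lt_succ_self M, (lt_of_not_ge hv).le, h1⟩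

/-- **Chord majorant**: for nodes with strict steps, a function `φ` convex on `[u 0, u M]`, numbers `Φ p ≥ φ (u p)` with
`Φ p ≥ 0`, and `v ∈ [u 0, u M]`: `φ v ≤ Σ_{p ≤ M} hat_p(v) · Φ p`. [cite: HardyLittlewoodPolya1952, §3.5] -/
theorem le_sum_hat_mul {u : ℕ → ℝ} {M : ℕ} (hM : 1 ≤ M) (hu : ∀ p < M, u p < u (p + 1))
    {φ : ℝ → ℝ} (hφ : ConvexOn ℝ (Icc (u 0) (u M)) φ) {Φ : ℕ → ℝ}
    (hΦ : ∀ p ≤ M, φ (u p) ≤ Φ p) (hΦ0 : ∀ p ≤ M, 0 ≤ Φ p) {v : ℝ} (hv : v ∈ Icc (u 0) (u M)) :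
    φ v ≤ ∑ p ∈ Finset.range (M + 1), hat u M p v * Φ p := by
  obtain ⟨k, hkM, hk1, hk2⟩ := exists_cell hM hv.1 hv.2
  have hΔ : 0 < u (k + 1) - u k := sub_pos.2 (hu k hkM)
  set a : ℝ := (u (k + 1) - v) / (u (k + 1) - u k) with ha
  set b : ℝ := (v - u k) / (u (k + 1) - u k) with hb
  have ha0 : 0 ≤ a := div_nonneg (by linarith) hΔ.le
  have hb0 : 0 ≤ b := div_nonneg (by linarith) hΔ.le
  have hab : a + b = 1 := by rw [ha, hb]; field_simp; ring
  have ha1 : a ≤ 1 := by linarith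
  have hb1 : b ≤ 1 := by linarith
  have hcomb : a • u k + b • u (k + 1) = v := by
    simp only [smul_eq_mul]; rw [ha, hb]; field_simp; ring
  have hmem1 : u k ∈ Icc (u 0) (u M) :=
    ⟨node_mono hu 0 k (Nat.zero_le _) hkM.le, node_mono hu k M hkM.le le_rfl⟩
  have hmem2 : u (k + 1) ∈ Icc (u 0) (u M) :=
    ⟨node_mono hu 0 (k + 1) (Nat.zero_le _) hkM, node_mono hu (k + 1) M hkM le_rfl⟩
  -- convexity on the cell
  have hconv : φ v ≤ a * φ (u k) + b * φ (u (k + 1)) := by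
    have h := hφ.2 hmem1 hmem2 ha0 hb0 hab
    rw [hcomb] at h
    simpa only [smul_eq_mul] using h
  have hstep : φ v ≤ a * Φ k + b * Φ (k + 1) := by
    have h1 := mul_le_mul_of_nonneg_left (hΦ k hkM.le) ha0
    have h2 := mul_le_mul_of_nonneg_left (hΦ (k + 1) hkM) hb0
    linarith
  -- the two hats at `v`
  have hhatk : a ≤ hat u M k v := by
    unfold hat
    by_cases hk0 : k = 0
    · subst hk0
      rw [if_pos rfl]
      exact le_max_of_le_right (by rw [ha])
    · rw [if_neg hk0, if_neg (Nat.ne_of_lt hkM)]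
      refine le_max_of_le_right (le_min ?_ (by rw [ha]))
      -- ascending part ≥ 1 ≥ a
      have hkpos : 1 ≤ k := Nat.one_le_iff_ne_zero.2 hk0
      have hprev : u (k - 1) < u k := by
        have := hu (k - 1) (by omega)
        rwa [Nat.sub_add_cancel hkpos] at this
      have : 1 ≤ (v - u (k - 1)) / (u k - u (k - 1)) := by
        rw [le_div_iff₀ (sub_pos.2 hprev)]; linarith
      exact ha1.trans this
  have hhatk1 : b ≤ hat u M (k + 1) v := by
    unfold hat
    rw [if_neg (Nat.succ_ne_zero k)]
    by_cases hkM' : k + 1 = M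
    · rw [if_pos hkM']
      refine le_max_of_le_right (le_of_eq ?_)
      rw [hb, ← hkM', Nat.add_sub_cancel]
    · rw [if_neg hkM']
      refine le_max_of_le_right (le_min (by rw [hb, Nat.add_sub_cancel]) ?_)
      have hnext : u (k + 1) < u (k + 2) := hu (k + 1) (by omega)
      have : 1 ≤ (u (k + 1 + 1) - v) / (u (k + 1 + 1) - u (k + 1)) := by
        rw [le_div_iff₀ (sub_pos.2 hnext)]; linarith
      exact hb1.trans this
  -- two nonnegative terms of the sum
  have hpair : hat u M k v * Φ k + hat u M (k + 1) v * Φ (k + 1) ≤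
      ∑ p ∈ Finset.range (M + 1), hat u M p v * Φ p := by
    have hsub : ({k, k + 1} : Finset ℕ) ⊆ Finset.range (M + 1) := by
      intro x hx
      simp only [Finset.mem_insert, Finset.mem_singleton] at hx
      rw [Finset.mem_range]; omega
    have h := Finset.sum_le_sum_of_subset_of_nonneg hsub
      (f := fun p => hat u M p v * Φ p) fun p hp _ =>
        mul_nonneg (hat_nonneg u M p v) (hΦ0 p (Nat.lt_succ_iff.1 (Finset.mem_range.1 hp)))
    rwa [Finset.sum_pair (Nat.succ_ne_self k).symm] at h
  have h1 := mul_le_mul_of_nonneg_right hhatk (hΦ0 k hkM.le)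
  have h2 := mul_le_mul_of_nonneg_right hhatk1 (hΦ0 (k + 1) hkM)
  linarith

/-! ### §3 Tensor form -/

/-- **Bilinear hat majorant**: `g ≥ 0` convex in each variable on `[u 0, u M]`, `G p q ≥ g (u p) (u q)` ⟹
`g a b ≤ Σ_p Σ_q G p q · hat_p(a) · hat_q(b)` on the square. [cite: DavisRabinowitz1984, Sect. 2.1] -/
theorem le_sum_sum_hat_mul {u : ℕ → ℝ} {M : ℕ} (hM : 1 ≤ M) (hu : ∀ p < M, u p < u (p + 1))
    {g : ℝ → ℝ → ℝ} (hg0 : ∀ a b, 0 ≤ g a b)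
    (hga : ∀ b, ConvexOn ℝ (Icc (u 0) (u M)) (fun a => g a b))
    (hgb : ∀ a, ConvexOn ℝ (Icc (u 0) (u M)) (g a))
    {G : ℕ → ℕ → ℝ} (hG : ∀ p ≤ M, ∀ q ≤ M, g (u p) (u q) ≤ G p q)
    {a b : ℝ} (ha : a ∈ Icc (u 0) (u M)) (hb : b ∈ Icc (u 0) (u M)) :
    g a b ≤ ∑ p ∈ Finset.range (M + 1), ∑ q ∈ Finset.range (M + 1), G p q * hat u M p a * hat u M q b := by
  have hG0 : ∀ p ≤ M, ∀ q ≤ M, 0 ≤ G p q := fun p hp q hq => (hg0 _ _).trans (hG p hp q hq)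
  -- first variable
  have h1 : g a b ≤ ∑ p ∈ Finset.range (M + 1), hat u M p a * g (u p) b :=
    le_sum_hat_mul hM hu (hga b) (fun p _ => le_rfl) (fun p _ => hg0 _ _) ha
  refine h1.trans (Finset.sum_le_sum fun p hp => ?_)
  have hpM : p ≤ M := Nat.lt_succ_iff.1 (Finset.mem_range.1 hp)
  -- second variable at node `p`
  have h2 : g (u p) b ≤ ∑ q ∈ Finset.range (M + 1), hat u M q b * G p q :=
    le_sum_hat_mul hM hu (hgb (u p)) (fun q hq => hG p hpM q hq) (fun q hq => hG0 p hpM q hq) hb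
  have h3 := mul_le_mul_of_nonneg_left h2 (hat_nonneg u M p a)
  refine h3.trans (le_of_eq ?_)
  rw [Finset.mul_sum]
  refine Finset.sum_congr rfl fun q _ => ?_
  ring

/-! ### §4 The positive-part cosine integral `R` -/

/-- **`∫_{-π}^{π} (cos x - cos θ)⁺ dx = 2 (sin θ - θ cos θ)`** for `θ ∈ [0, π]`. [cite: Rudin1976, Thm 6.12] -/
theorem integral_relu_cos_sub_cos {θ : ℝ} (h0 : 0 ≤ θ) (hπ : θ ≤ π) :
    ∫ x in -π..π, max (Real.cos x - Real.cos θ) 0 = 2 * (Real.sin θ - θ * Real.cos θ) := by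
  have hcont : Continuous fun x => max (Real.cos x - Real.cos θ) 0 :=
    (Real.continuous_cos.sub continuous_const).max continuous_const
  have hii : ∀ a b : ℝ, IntervalIntegrable (fun x => max (Real.cos x - Real.cos θ) 0) volume a b :=
    fun a b => hcont.intervalIntegrable a b
  -- outside `[-θ, θ]` the integrand vanishes
  have hout : ∀ x, θ ≤ |x| → |x| ≤ π → max (Real.cos x - Real.cos θ) 0 = 0 := by
    intro x h1 h2
    have hc : Real.cos x ≤ Real.cos θ := by
      rw [← Real.cos_abs x]
      exact Real.cos_le_cos_of_nonneg_of_le_pi h0 h2 h1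
    exact max_eq_right (by linarith)
  have hin : ∀ x, |x| ≤ θ → max (Real.cos x - Real.cos θ) 0 = Real.cos x - Real.cos θ := by
    intro x h1
    have hc : Real.cos θ ≤ Real.cos x := by
      rw [← Real.cos_abs x]
      exact Real.cos_le_cos_of_nonneg_of_le_pi (abs_nonneg x) hπ h1
    exact max_eq_left (by linarith)
  have hsplit := (intervalIntegral.integral_add_adjacent_intervals (hii (-π) (-θ)) (hii (-θ) θ)).symm
  have hsplit2 := (intervalIntegral.integral_add_adjacent_intervals
    ((hii (-π) (-θ)).trans (hii (-θ) θ)) (hii θ π)).symm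
  rw [hsplit2, hsplit]
  have I1 : ∫ x in -π..-θ, max (Real.cos x - Real.cos θ) 0 = 0 := by
    rw [intervalIntegral.integral_congr (g := fun _ => (0 : ℝ)) fun x hx => ?_]
    · simp
    · rw [Set.uIcc_of_le (by linarith)] at hx
      exact hout x (by rw [abs_of_nonpos (by linarith [hx.2])]; linarith [hx.2])
        (by rw [abs_of_nonpos (by linarith [hx.2])]; linarith [hx.1])
  have I3 : ∫ x in θ..π, max (Real.cos x - Real.cos θ) 0 = 0 := by
    rw [intervalIntegral.integral_congr (g := fun _ => (0 : ℝ)) fun x hx => ?_]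
    · simp
    · rw [Set.uIcc_of_le hπ] at hx
      exact hout x (by rw [abs_of_nonneg (h0.trans hx.1)]; exact hx.1)
        (by rw [abs_of_nonneg (h0.trans hx.1)]; exact hx.2)
  have I2 : ∫ x in -θ..θ, max (Real.cos x - Real.cos θ) 0 = 2 * (Real.sin θ - θ * Real.cos θ) := by
    rw [intervalIntegral.integral_congr (g := fun x => Real.cos x - Real.cos θ) fun x hx => ?_]
    · rw [intervalIntegral.integral_sub (Real.continuous_cos.intervalIntegrable _ _)
        (continuous_const.intervalIntegrable _ _),
        integral_cos, intervalIntegral.integral_const, Real.sin_neg]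
      simp only [smul_eq_mul]
      ring
    · rw [Set.uIcc_of_le (by linarith)] at hx
      exact hin x (abs_le.2 ⟨hx.1, hx.2⟩)
  rw [I1, I2, I3]
  ring

/-! ### §5 The hat integrals `Ω_p` -/

/-- `∫_{-π}^{π} (cos x - c)⁺ dx`, the building block of the `Ω_p`. [cite: Rudin1976, Thm 6.12] -/
noncomputable def reluCosInt (c : ℝ) : ℝ := ∫ x in -π..π, max (Real.cos x - c) 0

/-- Continuity of `x ↦ (cos x - c)⁺`. [folklore] -/
private theorem continuous_relu_cos (c : ℝ) : Continuous fun x => max (Real.cos x - c) 0 :=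
  (Real.continuous_cos.sub continuous_const).max continuous_const

/-- Interior hats are combinations of three positive parts. [folklore] -/
private theorem hat_interior_eq {u : ℕ → ℝ} {M p : ℕ} (hp0 : p ≠ 0) (hpM : p ≠ M)
    (h1 : u (p - 1) < u p) (h2 : u p < u (p + 1)) (v : ℝ) :
    hat u M p v = max (v - u (p - 1)) 0 / (u p - u (p - 1))
      - (1 / (u p - u (p - 1)) + 1 / (u (p + 1) - u p)) * max (v - u p) 0
      + max (v - u (p + 1)) 0 / (u (p + 1) - u p) := by
  unfold hat
  rw [if_neg hp0, if_neg hpM]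
  have hA := sub_pos.2 h1
  have hB := sub_pos.2 h2
  rcases le_or_gt v (u (p - 1)) with hv1 | hv1
  · -- left of the support
    rw [max_eq_right (sub_nonpos.2 hv1), max_eq_right (by linarith : v - u p ≤ 0),
      max_eq_right (by linarith : v - u (p + 1) ≤ 0)]
    rw [max_eq_left]
    · simp
    · exact min_le_of_left_le (div_nonpos_of_nonpos_of_nonneg (sub_nonpos.2 hv1) hA.le)
  rcases le_or_gt v (u p) with hv2 | hv2
  · -- ascending part
    rw [max_eq_left (sub_nonneg.2 hv1.le), max_eq_right (sub_nonpos.2 hv2),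
      max_eq_right (by linarith : v - u (p + 1) ≤ 0)]
    have hmin : min ((v - u (p - 1)) / (u p - u (p - 1))) ((u (p + 1) - v) / (u (p + 1) - u p)) =
        (v - u (p - 1)) / (u p - u (p - 1)) := by
      apply min_eq_left
      rw [div_le_div_iff₀ hA hB]
      nlinarith
    rw [hmin, max_eq_right (div_nonneg (sub_nonneg.2 hv1.le) hA.le)]
    ring
  rcases le_or_gt v (u (p + 1)) with hv3 | hv3
  · -- descending part
    rw [max_eq_left (sub_nonneg.2 hv1.le), max_eq_left (sub_nonneg.2 hv2.le),
      max_eq_right (sub_nonpos.2 hv3)]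
    have hmin : min ((v - u (p - 1)) / (u p - u (p - 1))) ((u (p + 1) - v) / (u (p + 1) - u p)) =
        (u (p + 1) - v) / (u (p + 1) - u p) := by
      apply min_eq_right
      rw [div_le_div_iff₀ hB hA]
      nlinarith
    rw [hmin, max_eq_right (div_nonneg (sub_nonneg.2 hv3) hB.le)]
    field_simp
    ring
  · -- right of the support
    rw [max_eq_left (sub_nonneg.2 hv1.le), max_eq_left (sub_nonneg.2 hv2.le),
      max_eq_left (sub_nonneg.2 hv3.le)]
    have hmin : min ((v - u (p - 1)) / (u p - u (p - 1))) ((u (p + 1) - v) / (u (p + 1) - u p)) ≤ 0 :=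
      min_le_of_right_le (div_nonpos_of_nonpos_of_nonneg (by linarith) hB.le)
    rw [max_eq_left hmin]
    field_simp
    ring

/-- **Interior hat integral**: `0 < p < M` ⟹
`∫_{-π}^{π} hat_p(cos x) dx = (R(u_{p-1}) - R(u_p))/(u_p - u_{p-1}) - (R(u_p) - R(u_{p+1}))/(u_{p+1} - u_p)`.
[cite: DavisRabinowitz1984, Sect. 2.1] -/
theorem integral_hat_cos_interior {u : ℕ → ℝ} {M p : ℕ} (hp0 : p ≠ 0) (hpM : p ≠ M)
    (h1 : u (p - 1) < u p) (h2 : u p < u (p + 1)) :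
    ∫ x in -π..π, hat u M p (Real.cos x) =
      (reluCosInt (u (p - 1)) - reluCosInt (u p)) / (u p - u (p - 1))
        - (reluCosInt (u p) - reluCosInt (u (p + 1))) / (u (p + 1) - u p) := by
  simp_rw [hat_interior_eq hp0 hpM h1 h2]
  have iA : IntervalIntegrable (fun x => max (Real.cos x - u (p - 1)) 0) volume (-π) π :=
    (continuous_relu_cos (u (p - 1))).intervalIntegrable (-π) π
  have iB : IntervalIntegrable (fun x => max (Real.cos x - u p) 0) volume (-π) π :=
    (continuous_relu_cos (u p)).intervalIntegrable (-π) π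
  have iC : IntervalIntegrable (fun x => max (Real.cos x - u (p + 1)) 0) volume (-π) π :=
    (continuous_relu_cos (u (p + 1))).intervalIntegrable (-π) π
  rw [intervalIntegral.integral_add ((iA.div_const _).sub (iB.const_mul _)) (iC.div_const _),
    intervalIntegral.integral_sub (iA.div_const _) (iB.const_mul _),
    intervalIntegral.integral_div, intervalIntegral.integral_const_mul, intervalIntegral.integral_div]
  unfold reluCosInt
  have hA := sub_pos.2 h1
  have hB := sub_pos.2 h2
  field_simp
  ring

/-- **Left boundary hat integral**: `∫_{-π}^{π} hat_0(cos x) dx = (2π u_1 + R(u_1))/(u_1 - u_0)`.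
[cite: DavisRabinowitz1984, Sect. 2.1] -/
theorem integral_hat_cos_zero {u : ℕ → ℝ} {M : ℕ} (h1 : u 0 < u 1) :
    ∫ x in -π..π, hat u M 0 (Real.cos x) = (2 * π * u 1 + reluCosInt (u 1)) / (u 1 - u 0) := by
  have hΔ := sub_pos.2 h1
  have hpt : ∀ v, hat u M 0 v = ((u 1 - v) + max (v - u 1) 0) / (u 1 - u 0) := by
    intro v
    unfold hat
    rw [if_pos rfl]
    rcases le_or_gt v (u 1) with hv | hv
    · rw [max_eq_right (div_nonneg (sub_nonneg.2 hv) hΔ.le), max_eq_right (sub_nonpos.2 hv), add_zero]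
    · rw [max_eq_left (div_nonpos_of_nonpos_of_nonneg (by linarith) hΔ.le), max_eq_left (by linarith : 0 ≤ v - u 1)]
      simp
  simp_rw [hpt]
  have i1 : IntervalIntegrable (fun x => u 1 - Real.cos x) volume (-π) π :=
    (continuous_const.sub Real.continuous_cos).intervalIntegrable _ _
  have i2 : IntervalIntegrable (fun x => max (Real.cos x - u 1) 0) volume (-π) π :=
    (continuous_relu_cos (u 1)).intervalIntegrable _ _
  rw [intervalIntegral.integral_div, intervalIntegral.integral_add i1 i2,
    intervalIntegral.integral_sub (continuous_const.intervalIntegrable _ _)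
      (Real.continuous_cos.intervalIntegrable _ _),
    intervalIntegral.integral_const, integral_cos, Real.sin_neg, Real.sin_pi]
  unfold reluCosInt
  simp only [smul_eq_mul]
  ring

/-- **Right boundary hat integral**: `∫_{-π}^{π} hat_M(cos x) dx = R(u_{M-1})/(u_M - u_{M-1})` (`M ≠ 0`).
[cite: DavisRabinowitz1984, Sect. 2.1] -/
theorem integral_hat_cos_last {u : ℕ → ℝ} {M : ℕ} (hM : M ≠ 0) (h1 : u (M - 1) < u M) :
    ∫ x in -π..π, hat u M M (Real.cos x) = reluCosInt (u (M - 1)) / (u M - u (M - 1)) := by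
  have hΔ := sub_pos.2 h1
  have hpt : ∀ v, hat u M M v = max (v - u (M - 1)) 0 / (u M - u (M - 1)) := by
    intro v
    unfold hat
    rw [if_neg hM, if_pos rfl]
    rcases le_or_gt v (u (M - 1)) with hv | hv
    · rw [max_eq_left (div_nonpos_of_nonpos_of_nonneg (sub_nonpos.2 hv) hΔ.le), max_eq_right (sub_nonpos.2 hv)]
      simp
    · rw [max_eq_right (div_nonneg (by linarith) hΔ.le), max_eq_left (by linarith : 0 ≤ v - u (M - 1))]
  simp_rw [hpt]
  rw [intervalIntegral.integral_div]
  unfold reluCosInt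
  rfl

/-! ### §6 The quadrature inequality on the Brillouin square -/

/-- Fubini for a product integrand on `brillouin 2 = [-π,π]²`. [cite: Rudin1976, Thm 6.12] -/
private theorem setIntegral_brillouin_two_mul (A B : ℝ → ℝ) :
    ∫ k in brillouin 2, A (k 0) * B (k 1) = (∫ x in -π..π, A x) * (∫ x in -π..π, B x) := by
  have hprod : (fun k : Fin 2 → ℝ => A (k 0) * B (k 1)) = fun k => ∏ i : Fin 2, (![A, B] i) (k i) := by
    funext k
    rw [Fin.prod_univ_two]
    rfl
  rw [hprod, volume_restrict_brillouin 2,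
    integral_fintype_prod_eq_prod (f := fun i : Fin 2 => (![A, B] i)), Fin.prod_univ_two]
  have hle : (-π : ℝ) ≤ π := by linarith [Real.pi_pos]
  simp only [Matrix.cons_val_zero, Matrix.cons_val_one]
  rw [integral_Icc_eq_integral_Ioc, integral_Icc_eq_integral_Ioc,
    ← intervalIntegral.integral_of_le hle, ← intervalIntegral.integral_of_le hle]

/-- **The hat-majorant quadrature inequality on `[-π,π]²`**: nodes `u 0 = -1 < … < u M = 1` (`M ≥ 1`), `g ≥ 0` continuous
and convex in each variable on `[-1,1]`, `G p q ≥ g (u p) (u q)` ⟹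
`∫_{brillouin 2} g(cos k₀, cos k₁) dk ≤ Σ_{p,q ≤ M} G p q · Ω_p · Ω_q`, `Ω_p = ∫_{-π}^{π} hat_p(cos x) dx`.
[cite: DavisRabinowitz1984, Sect. 2.1] -/
theorem setIntegral_brillouin_two_le_sum_hat {u : ℕ → ℝ} {M : ℕ} (hM : 1 ≤ M)
    (hu : ∀ p < M, u p < u (p + 1)) (hu0 : u 0 = -1) (huM : u M = 1)
    {g : ℝ → ℝ → ℝ} (hgc : Continuous fun ab : ℝ × ℝ => g ab.1 ab.2) (hg0 : ∀ a b, 0 ≤ g a b)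
    (hga : ∀ b, ConvexOn ℝ (Icc (-1) 1) (fun a => g a b)) (hgb : ∀ a, ConvexOn ℝ (Icc (-1) 1) (g a))
    {G : ℕ → ℕ → ℝ} (hG : ∀ p ≤ M, ∀ q ≤ M, g (u p) (u q) ≤ G p q) :
    ∫ k in brillouin 2, g (Real.cos (k 0)) (Real.cos (k 1)) ≤
      ∑ p ∈ Finset.range (M + 1), ∑ q ∈ Finset.range (M + 1),
        G p q * (∫ x in -π..π, hat u M p (Real.cos x)) * (∫ x in -π..π, hat u M q (Real.cos x)) := by
  have hIcc : Icc (u 0) (u M) = Icc (-1 : ℝ) 1 := by rw [hu0, huM]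
  -- pointwise majorant
  have hpt : ∀ k : Fin 2 → ℝ, g (Real.cos (k 0)) (Real.cos (k 1)) ≤
      ∑ p ∈ Finset.range (M + 1), ∑ q ∈ Finset.range (M + 1),
        G p q * hat u M p (Real.cos (k 0)) * hat u M q (Real.cos (k 1)) := by
    intro k
    refine le_sum_sum_hat_mul hM hu hg0 (fun b => by rw [hIcc]; exact hga b) (fun a => by rw [hIcc]; exact hgb a)
      hG ?_ ?_
    · rw [hIcc]; exact ⟨Real.neg_one_le_cos _, Real.cos_le_one _⟩
    · rw [hIcc]; exact ⟨Real.neg_one_le_cos _, Real.cos_le_one _⟩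
  -- continuity / integrability
  have hc0 : Continuous fun k : Fin 2 → ℝ => Real.cos (k 0) := Real.continuous_cos.comp (continuous_apply 0)
  have hc1 : Continuous fun k : Fin 2 → ℝ => Real.cos (k 1) := Real.continuous_cos.comp (continuous_apply 1)
  have hcg : Continuous fun k : Fin 2 → ℝ => g (Real.cos (k 0)) (Real.cos (k 1)) :=
    hgc.comp (hc0.prodMk hc1)
  have hterm : ∀ p q, Continuous fun k : Fin 2 → ℝ =>
      G p q * hat u M p (Real.cos (k 0)) * hat u M q (Real.cos (k 1)) := fun p q =>
    (continuous_const.mul ((continuous_hat u M p).comp hc0)).mul ((continuous_hat u M q).comp hc1)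
  have hK := isCompact_brillouin 2
  have hint : ∀ {f : (Fin 2 → ℝ) → ℝ}, Continuous f → IntegrableOn f (brillouin 2) volume := fun hf =>
    hf.continuousOn.integrableOn_compact hK
  calc ∫ k in brillouin 2, g (Real.cos (k 0)) (Real.cos (k 1))
      ≤ ∫ k in brillouin 2, ∑ p ∈ Finset.range (M + 1), ∑ q ∈ Finset.range (M + 1),
          G p q * hat u M p (Real.cos (k 0)) * hat u M q (Real.cos (k 1)) := by
        refine setIntegral_mono_on (hint hcg) (hint ?_) (measurableSet_brillouin 2) fun k _ => hpt k
        exact continuous_finsetSum _ fun p _ => continuous_finsetSum _ fun q _ => hterm p q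
    _ = ∑ p ∈ Finset.range (M + 1), ∑ q ∈ Finset.range (M + 1),
          ∫ k in brillouin 2, G p q * hat u M p (Real.cos (k 0)) * hat u M q (Real.cos (k 1)) := by
        rw [integral_finsetSum _ fun p _ => ?_]
        · refine Finset.sum_congr rfl fun p _ => ?_
          rw [integral_finsetSum _ fun q _ => (hint (hterm p q))]
        · exact (integrable_finsetSum _ fun q _ => (hint (hterm p q)))
    _ = _ := by
        refine Finset.sum_congr rfl fun p _ => Finset.sum_congr rfl fun q _ => ?_
        have h := setIntegral_brillouin_two_mul (fun x => hat u M p (Real.cos x)) (fun x => hat u M q (Real.cos x))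
        simp_rw [mul_assoc]
        rw [integral_const_mul, h]

end KernelQuadrature

end Literature.Analysis.Quadrature
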